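import Mathlib
import HarnessLib
import Summits.Ventures.LatticeQCDFlow.Scoring.ChainPathLaw

/-!
# The split chain of a Doeblin kernel: a coin-augmented chain on `Ω × Bool` whose first coordinate
# IS the `κ`-chain (as a law on path space) and which regenerates from `ν` at every head

HONEST FRAMING: exact (Metropolis-corrected) sampling algorithms for lattice gauge theory;
figures of merit are autocorrelation/cost numbers at stated couplings and volumes; no
continuum-physics claim.

Venture `LatticeQCDFlow` (cell pub-lqcd), topic `Scoring`; FANOUT row 8 (`s0-cpn-nemc`, GEN-15).
NEW WORK of the cell, not a published result; no definition is introduced.  Every any-start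
certificate of the row takes one input, a Doeblin minorisation `κ(x, ·) ≥ ε ν` of the simulated
kernel, and uses it through the splitting `κ = ε ν + (1 − ε) R` of the tree's Doeblin formalisation
(`Literature.Probability.MarkovChains.Doeblin.residualKernel`, Meyn–Tweedie 1993 Thm 16.2.4).  The
splitting has a pathwise meaning — Nummelin's SPLIT CHAIN: before each update flip an `ε`-coin; on
heads draw the new state from `ν` (a REGENERATION, independent of everything before), on tails move
with `R`.  This file realises that chain as a Markov kernel `κ̂` on `Ω × Bool` (second coordinate =
the coin that produced the current state) and proves, with the uniqueness / functoriality theorems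
of `Scoring/ChainPathLaw.lean`: (i) the state coordinate of the `κ̂`-chain IS the `κ`-chain — an
identity of laws on path space, so every statement about the simulated chain may be proved on the
split chain; (ii) the coin coordinate is the chain with the constant kernel
`ε δ_true + (1 − ε) δ_false` (a Bernoulli(`ε`) sequence); (iii) REGENERATION at the next step:
conditionally on any past, the next coin is heads with probability `ε` and then the new state is
`ν`-distributed.  Later states and the packaged statement are in
`Scoring/SplitChainRegeneration.lean`.  Printed counterpart NAMED ONLY: the Nummelin splitting /
Athreya–Ney regeneration construction (Nummelin 1978, *A splitting technique for Harris recurrent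
Markov chains*, Z. Wahrsch. 43; Athreya–Ney 1978, Trans. AMS 245; Meyn–Tweedie 1993 §5.1) — here in
the atom-free "Doeblin" case where the whole space is small; nothing is cited as a fact.

## Content (`κ` Markov on `Ω`, `ν` a probability law, `κ(x, B) ≥ ε ν(B)`, `ε < 1`,
## `R = Doeblin.residualKernel κ ν ε hmin`; a SPLIT KERNEL is any Markov kernel `κ̂` on `Ω × Bool`
## with `κ̂ (x, b) = (ε ν) ⊗ δ_true + ((1 − ε) R x) ⊗ δ_false`, written with `Measure.map`)

* **`exists_splitKernel`** — a split kernel exists (and is Markov);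
* `splitKernel_map_fst` — `(κ̂ (x, b)).map fst = κ x`; `splitKernel_map_snd` —
  `(κ̂ (x, b)).map snd = ε δ_true + (1 − ε) δ_false`; `splitKernel_kop`, `splitKernel_kop_comp_fst`,
  `splitKernel_iterate_kop_comp_fst`, `splitKernel_kop_heads` — the transition operator of `κ̂` on
  test functions, on functions of the state alone (`kop κ̂ (h ∘ fst) = (kop κ h) ∘ fst`), and on
  "heads × g(state)" (`= ε ν(g)`, a CONSTANT);
* **`splitChain_map_fst`** — THE STATE COORDINATE OF THE SPLIT CHAIN IS THE `κ`-CHAIN: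
  `P̂_{μ̂₀,κ̂}.map (x̂ ↦ fst ∘ x̂) = P_{μ̂₀.map fst, κ}` (Dynkin lumping, `chain_map_of_intertwining`);
  **`splitChain_map_snd`** — the coin coordinate is the chain of the constant kernel
  `ε δ_true + (1 − ε) δ_false`;
* **`splitChain_regeneration`** — for every `a`, bounded measurable history functional `F` and
  bounded measurable `g`:
  `E[F(X̂_{≤a}) · 1{coin_{a+1} = heads} · g(X_{a+1})] = ε · ν(g) · E[F(X̂_{≤a})]`;
  `splitChain_coin` — `E[F(X̂_{≤a}) · 1{coin_{a+1} = heads}] = ε · E[F(X̂_{≤a})]`.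

Reading (value-free): the certificate `ε` the row's files consume is, pathwise, a supply of
regeneration times arriving independently with probability `ε` per update; this file makes that
object available on the tree as a law on path space tied to the simulated chain by an identity, the
starting point for block-independence / regenerative error bars.  NOT CLAIMED: the strong Markov
property at the (random) regeneration times and the independence of the excursions between them
(fixed-time identities only are proved); any `ε` of a concrete sampler.
-/


noncomputable section

namespace Summit.Ventures.LatticeQCDFlow.Scoring

open MeasureTheory ProbabilityTheory Filter Finset Preorder Literature.Probability.MarkovChains
open scoped ENNReal

variable {Ω : Type*} [MeasurableSpace Ω]

/-! ### The split kernel -/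

section SplitKernel

variable {κ : Kernel Ω Ω} [IsMarkovKernel κ] {ν : Measure Ω} [IsProbabilityMeasure ν] {ε : ℝ≥0∞}
  {hmin : ∀ x {B : Set Ω}, MeasurableSet B → ε * ν B ≤ κ x B}

omit [IsMarkovKernel κ] [IsProbabilityMeasure ν] in
/-- Tagging a state with a coin value is measurable. -/
theorem measurable_tagCoin (b : Bool) : Measurable fun y : Ω => (y, b) :=
  measurable_id.prodMk measurable_const

/-- **A SPLIT KERNEL EXISTS**: there is a Markov kernel `κ̂` on `Ω × Bool` with
`κ̂ (x, b) = (ε ν).map (·, true) + ((1 − ε) R x).map (·, false)`. -/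
theorem exists_splitKernel (hε : ε < 1) :
    ∃ κs : Kernel (Ω × Bool) (Ω × Bool), IsMarkovKernel κs ∧
      ∀ p, κs p = (ε • ν).map (fun y : Ω => (y, true))
        + ((1 - ε) • Doeblin.residualKernel κ ν ε hmin p.1).map (fun y : Ω => (y, false)) := by
  haveI := Doeblin.isMarkovKernel_residualKernel (κ := κ) (ν := ν) (hmin := hmin) hε
  have hT : Measurable fun y : Ω => (y, true) := measurable_tagCoin true
  have hF : Measurable fun y : Ω => (y, false) := measurable_tagCoin false
  have hM : Measurable fun p : Ω × Bool => (ε • ν).map (fun y : Ω => (y, true))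
      + ((1 - ε) • Doeblin.residualKernel κ ν ε hmin p.1).map (fun y : Ω => (y, false)) := by
    refine Measure.measurable_of_measurable_coe _ fun A hA => ?_
    simp only [Measure.add_apply, Measure.map_apply hT hA, Measure.map_apply hF hA,
      Measure.smul_apply, smul_eq_mul]
    exact measurable_const.add
      (measurable_const.mul ((Kernel.measurable_coe _ (hF hA)).comp measurable_fst))
  refine ⟨⟨_, hM⟩, ⟨fun p => ⟨?_⟩⟩, fun p => rfl⟩
  show ((ε • ν).map (fun y : Ω => (y, true))
      + ((1 - ε) • Doeblin.residualKernel κ ν ε hmin p.1).map (fun y : Ω => (y, false)))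
      Set.univ = 1
  rw [Measure.add_apply, Measure.map_apply hT MeasurableSet.univ,
    Measure.map_apply hF MeasurableSet.univ, Set.preimage_univ, Set.preimage_univ,
    Measure.smul_apply, Measure.smul_apply, smul_eq_mul, smul_eq_mul, measure_univ, measure_univ,
    mul_one, mul_one]
  exact add_tsub_cancel_of_le hε.le

variable {κs : Kernel (Ω × Bool) (Ω × Bool)}

/-- The state marginal of one split step is one `κ` step: `(κ̂ (x, b)).map fst = κ x`. -/
theorem splitKernel_map_fst (hε : ε < 1)
    (hκs : ∀ p, κs p = (ε • ν).map (fun y : Ω => (y, true))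
      + ((1 - ε) • Doeblin.residualKernel κ ν ε hmin p.1).map (fun y : Ω => (y, false)))
    (p : Ω × Bool) : (κs p).map Prod.fst = κ p.1 := by
  rw [hκs p, Measure.map_add _ _ measurable_fst, Measure.map_smul, Measure.map_smul,
    Measure.map_map measurable_fst (measurable_tagCoin true),
    Measure.map_map measurable_fst (measurable_tagCoin false)]
  have h1 : Prod.fst ∘ (fun y : Ω => (y, true)) = id := rfl
  have h2 : Prod.fst ∘ (fun y : Ω => (y, false)) = id := rfl
  rw [h1, h2, Measure.map_id, Measure.map_id]
  exact (kernel_eq_add_residual (κ := κ) (π := ν) (hmin := hmin) hε p.1).symm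

/-- The coin marginal of one split step is Bernoulli(`ε`): `(κ̂ (x, b)).map snd = ε δ_true +
(1 − ε) δ_false`, whatever `(x, b)`. -/
theorem splitKernel_map_snd (hε : ε < 1)
    (hκs : ∀ p, κs p = (ε • ν).map (fun y : Ω => (y, true))
      + ((1 - ε) • Doeblin.residualKernel κ ν ε hmin p.1).map (fun y : Ω => (y, false)))
    (p : Ω × Bool) :
    (κs p).map Prod.snd = ε • Measure.dirac true + (1 - ε) • Measure.dirac false := by
  haveI := Doeblin.isMarkovKernel_residualKernel (κ := κ) (ν := ν) (hmin := hmin) hε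
  rw [hκs p, Measure.map_add _ _ measurable_snd]
  simp only [Measure.map_smul, Measure.map_map measurable_snd (measurable_tagCoin true),
    Measure.map_map measurable_snd (measurable_tagCoin false)]
  have h1 : Prod.snd ∘ (fun y : Ω => (y, true)) = fun _ => true := rfl
  have h2 : Prod.snd ∘ (fun y : Ω => (y, false)) = fun _ => false := rfl
  rw [h1, h2, Measure.map_const, Measure.map_const, measure_univ, measure_univ, one_smul, one_smul]

/-- **The transition operator of the split kernel** on a bounded measurable test function:
`kop κ̂ G (x, b) = ε ∫ G(y, true) ν(dy) + (1 − ε) ∫ G(y, false) R(x, dy)`. -/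
theorem splitKernel_kop (hε : ε < 1)
    (hκs : ∀ p, κs p = (ε • ν).map (fun y : Ω => (y, true))
      + ((1 - ε) • Doeblin.residualKernel κ ν ε hmin p.1).map (fun y : Ω => (y, false)))
    {G : Ω × Bool → ℝ} (hG : Measurable G) {C : ℝ} (hC : ∀ p, |G p| ≤ C) (p : Ω × Bool) :
    kop κs G p = ε.toReal * ∫ y, G (y, true) ∂ν
      + (1 - ε).toReal * ∫ y, G (y, false) ∂(Doeblin.residualKernel κ ν ε hmin p.1) := by
  haveI := Doeblin.isMarkovKernel_residualKernel (κ := κ) (ν := ν) (hmin := hmin) hε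
  have hT : Measurable fun y : Ω => (y, true) := measurable_tagCoin true
  have hF : Measurable fun y : Ω => (y, false) := measurable_tagCoin false
  have h1 : Integrable G ((ε • ν).map (fun y : Ω => (y, true))) :=
    (integrable_map_measure hG.aestronglyMeasurable hT.aemeasurable).2
      ((integrable_of_bounded ν (hG.comp hT) (fun y => hC _)).smul_measure (ne_top_of_lt hε))
  have h2 : Integrable G
      (((1 - ε) • Doeblin.residualKernel κ ν ε hmin p.1).map (fun y : Ω => (y, false))) :=
    (integrable_map_measure hG.aestronglyMeasurable hF.aemeasurable).2
      ((integrable_of_bounded _ (hG.comp hF) (fun y => hC _)).smul_measure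
        (ne_top_of_le_ne_top ENNReal.one_ne_top tsub_le_self))
  unfold kop
  rw [hκs p, integral_add_measure h1 h2, integral_map hT.aemeasurable hG.aestronglyMeasurable,
    integral_map hF.aemeasurable hG.aestronglyMeasurable, integral_smul_measure,
    integral_smul_measure, smul_eq_mul, smul_eq_mul]

/-- On functions of the state alone the split kernel acts as `κ`:
`kop κ̂ (h ∘ fst) = (kop κ h) ∘ fst`. -/
theorem splitKernel_kop_comp_fst (hε : ε < 1)
    (hκs : ∀ p, κs p = (ε • ν).map (fun y : Ω => (y, true))
      + ((1 - ε) • Doeblin.residualKernel κ ν ε hmin p.1).map (fun y : Ω => (y, false)))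
    {h : Ω → ℝ} (hh : Measurable h) : kop κs (h ∘ Prod.fst) = (kop κ h) ∘ Prod.fst := by
  funext p
  show ∫ q, (h ∘ Prod.fst) q ∂(κs p) = ∫ y, h y ∂(κ p.1)
  rw [← splitKernel_map_fst (κ := κ) (ν := ν) (hmin := hmin) hε hκs p,
    integral_map measurable_fst.aemeasurable hh.aestronglyMeasurable]
  rfl

/-- … iterated: `(kop κ̂)^[t] (h ∘ fst) = ((kop κ)^[t] h) ∘ fst` for bounded measurable `h`. -/
theorem splitKernel_iterate_kop_comp_fst (hε : ε < 1)
    (hκs : ∀ p, κs p = (ε • ν).map (fun y : Ω => (y, true))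
      + ((1 - ε) • Doeblin.residualKernel κ ν ε hmin p.1).map (fun y : Ω => (y, false)))
    {h : Ω → ℝ} (hh : Measurable h) {C : ℝ} (hC : ∀ x, |h x| ≤ C) :
    ∀ t : ℕ, (kop κs)^[t] (h ∘ Prod.fst) = ((kop κ)^[t] h) ∘ Prod.fst
  | 0 => rfl
  | t + 1 => by
    obtain ⟨hm, -⟩ := iterate_kop_bounded_measurable κ hh hC t
    rw [Function.iterate_succ_apply', Function.iterate_succ_apply',
      splitKernel_iterate_kop_comp_fst hε hκs hh hC t,
      splitKernel_kop_comp_fst (κ := κ) (ν := ν) (hmin := hmin) hε hκs hm]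

omit [IsMarkovKernel κ] [IsProbabilityMeasure ν] in
/-- The test function "heads, times `g` of the state" is measurable … -/
theorem measurable_headsMul {g : Ω → ℝ} (hg : Measurable g) :
    Measurable fun p : Ω × Bool => if p.2 then g p.1 else 0 := by
  refine Measurable.ite ?_ (hg.comp measurable_fst) measurable_const
  exact measurable_snd (measurableSet_singleton true)

omit [MeasurableSpace Ω] [IsMarkovKernel κ] [IsProbabilityMeasure ν] in
/-- … and bounded by the bound of `g`. -/
theorem abs_headsMul_le {g : Ω → ℝ} {C : ℝ} (hC : ∀ x, |g x| ≤ C) (p : Ω × Bool) :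
    |(if p.2 then g p.1 else 0 : ℝ)| ≤ C := by
  split_ifs
  · exact hC _
  · rw [abs_zero]; exact (abs_nonneg _).trans (hC p.1)

/-- **On "heads × g(state)" the split kernel is CONSTANT**: `kop κ̂ (1{heads} g) = ε ν(g)`. -/
theorem splitKernel_kop_heads (hε : ε < 1)
    (hκs : ∀ p, κs p = (ε • ν).map (fun y : Ω => (y, true))
      + ((1 - ε) • Doeblin.residualKernel κ ν ε hmin p.1).map (fun y : Ω => (y, false)))
    {g : Ω → ℝ} (hg : Measurable g) {C : ℝ} (hC : ∀ x, |g x| ≤ C) (p : Ω × Bool) :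
    kop κs (fun q : Ω × Bool => if q.2 then g q.1 else 0) p = ε.toReal * ∫ y, g y ∂ν := by
  rw [splitKernel_kop (κ := κ) (ν := ν) (hmin := hmin) hε hκs (measurable_headsMul hg)
    (abs_headsMul_le hC) p]
  simp

end SplitKernel

/-! ### The split chain: marginals and regeneration -/

section SplitChain

variable {κ : Kernel Ω Ω} [IsMarkovKernel κ] {ν : Measure Ω} [IsProbabilityMeasure ν] {ε : ℝ≥0∞}
  {hmin : ∀ x {B : Set Ω}, MeasurableSet B → ε * ν B ≤ κ x B}
  (κs : Kernel (Ω × Bool) (Ω × Bool)) [IsMarkovKernel κs]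
  (μs : Measure (Ω × Bool)) [IsProbabilityMeasure μs]

/-- **THE STATE COORDINATE OF THE SPLIT CHAIN IS THE `κ`-CHAIN** (as a law on path space): the
image of `P̂_{μ̂₀,κ̂}` under `x̂ ↦ fst ∘ x̂` is `P_{μ̂₀.map fst, κ}`. -/
theorem splitChain_map_fst (hε : ε < 1)
    (hκs : ∀ p, κs p = (ε • ν).map (fun y : Ω => (y, true))
      + ((1 - ε) • Doeblin.residualKernel κ ν ε hmin p.1).map (fun y : Ω => (y, false))) :
    (Kernel.trajMeasure (X := fun _ : ℕ => Ω × Bool) μs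
        (fun n : ℕ => κs.comap (fun h : (i : ↥(Finset.Iic n)) → Ω × Bool =>
          h ⟨n, Finset.mem_Iic.2 le_rfl⟩) (measurable_pi_apply _))).map
        (fun (x : ℕ → Ω × Bool) (n : ℕ) => (x n).1)
      = Kernel.trajMeasure (X := fun _ : ℕ => Ω) (μs.map Prod.fst)
        (fun n : ℕ => κ.comap (fun h : (i : ↥(Finset.Iic n)) → Ω => h ⟨n, Finset.mem_Iic.2 le_rfl⟩)
          (measurable_pi_apply _)) :=
  chain_map_of_intertwining κ κs μs measurable_fst
    (fun p => splitKernel_map_fst (κ := κ) (ν := ν) (hmin := hmin) hε hκs p)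

omit [IsMarkovKernel κ] [IsProbabilityMeasure ν] in
/-- The Bernoulli(`ε`) law `ε δ_true + (1 − ε) δ_false` is a probability law (`ε ≤ 1`). -/
theorem isProbabilityMeasure_coin (hε : ε ≤ 1) :
    IsProbabilityMeasure (ε • Measure.dirac true + (1 - ε) • Measure.dirac false) :=
  ⟨by rw [Measure.add_apply, Measure.smul_apply, Measure.smul_apply, smul_eq_mul, smul_eq_mul,
    measure_univ, measure_univ, mul_one, mul_one, add_tsub_cancel_of_le hε]⟩

/-- **The coin coordinate of the split chain is the chain of the constant kernel
`ε δ_true + (1 − ε) δ_false`** (a Bernoulli(`ε`) sequence after time `0`). -/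
theorem splitChain_map_snd (hε : ε < 1)
    (hκs : ∀ p, κs p = (ε • ν).map (fun y : Ω => (y, true))
      + ((1 - ε) • Doeblin.residualKernel κ ν ε hmin p.1).map (fun y : Ω => (y, false))) :
    haveI := isProbabilityMeasure_coin hε.le
    (Kernel.trajMeasure (X := fun _ : ℕ => Ω × Bool) μs
        (fun n : ℕ => κs.comap (fun h : (i : ↥(Finset.Iic n)) → Ω × Bool =>
          h ⟨n, Finset.mem_Iic.2 le_rfl⟩) (measurable_pi_apply _))).map
        (fun (x : ℕ → Ω × Bool) (n : ℕ) => (x n).2)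
      = Kernel.trajMeasure (X := fun _ : ℕ => Bool) (μs.map Prod.snd)
        (fun n : ℕ => (Kernel.const Bool (ε • Measure.dirac true
            + (1 - ε) • Measure.dirac false)).comap
          (fun h : (i : ↥(Finset.Iic n)) → Bool => h ⟨n, Finset.mem_Iic.2 le_rfl⟩)
          (measurable_pi_apply _)) := by
  haveI := isProbabilityMeasure_coin hε.le
  exact chain_map_of_intertwining (Kernel.const Bool (ε • Measure.dirac true
      + (1 - ε) • Measure.dirac false)) κs μs measurable_snd
    (fun p => by rw [Kernel.const_apply]; exact splitKernel_map_snd (κ := κ) hε hκs p)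

/-- **REGENERATION AT THE NEXT STEP.**  For every time `a`, every bounded measurable functional `F`
of the split chain's history up to `a`, and every bounded measurable `g`:
`E[F(X̂_{≤a}) · 1{coin_{a+1} = heads} · g(X_{a+1})] = ε · ν(g) · E[F(X̂_{≤a})]` — given any past, the
next coin is heads with probability `ε`, and then the new state is drawn from `ν`. -/
theorem splitChain_regeneration (hε : ε < 1)
    (hκs : ∀ p, κs p = (ε • ν).map (fun y : Ω => (y, true))
      + ((1 - ε) • Doeblin.residualKernel κ ν ε hmin p.1).map (fun y : Ω => (y, false)))
    (a : ℕ) {F : ((i : ↥(Finset.Iic a)) → Ω × Bool) → ℝ} (hF : Measurable F) {CF : ℝ}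
    (hCF : ∀ h, |F h| ≤ CF) {g : Ω → ℝ} (hg : Measurable g) {Cg : ℝ} (hCg : ∀ x, |g x| ≤ Cg) :
    ∫ x, F (frestrictLe a x) * (if (x (a + 1)).2 then g (x (a + 1)).1 else 0)
        ∂(Kernel.trajMeasure (X := fun _ : ℕ => Ω × Bool) μs
          (fun n : ℕ => κs.comap (fun h : (i : ↥(Finset.Iic n)) → Ω × Bool =>
            h ⟨n, Finset.mem_Iic.2 le_rfl⟩) (measurable_pi_apply _)))
      = ε.toReal * (∫ y, g y ∂ν) * ∫ x, F (frestrictLe a x)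
        ∂(Kernel.trajMeasure (X := fun _ : ℕ => Ω × Bool) μs
          (fun n : ℕ => κs.comap (fun h : (i : ↥(Finset.Iic n)) → Ω × Bool =>
            h ⟨n, Finset.mem_Iic.2 le_rfl⟩) (measurable_pi_apply _))) := by
  rw [chain_tower κs μs a hF hCF (measurable_headsMul hg) (abs_headsMul_le hCg)]
  simp_rw [splitKernel_kop_heads (κ := κ) (ν := ν) (hmin := hmin) hε hκs hg hCg]
  rw [integral_mul_const, mul_comm]

/-- **The coin alone**: `E[F(X̂_{≤a}) · 1{coin_{a+1} = heads}] = ε · E[F(X̂_{≤a})]`. -/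
theorem splitChain_coin (hε : ε < 1)
    (hκs : ∀ p, κs p = (ε • ν).map (fun y : Ω => (y, true))
      + ((1 - ε) • Doeblin.residualKernel κ ν ε hmin p.1).map (fun y : Ω => (y, false)))
    (a : ℕ) {F : ((i : ↥(Finset.Iic a)) → Ω × Bool) → ℝ} (hF : Measurable F) {CF : ℝ}
    (hCF : ∀ h, |F h| ≤ CF) :
    ∫ x, F (frestrictLe a x) * (if (x (a + 1)).2 then (1 : ℝ) else 0)
        ∂(Kernel.trajMeasure (X := fun _ : ℕ => Ω × Bool) μs
          (fun n : ℕ => κs.comap (fun h : (i : ↥(Finset.Iic n)) → Ω × Bool =>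
            h ⟨n, Finset.mem_Iic.2 le_rfl⟩) (measurable_pi_apply _)))
      = ε.toReal * ∫ x, F (frestrictLe a x)
        ∂(Kernel.trajMeasure (X := fun _ : ℕ => Ω × Bool) μs
          (fun n : ℕ => κs.comap (fun h : (i : ↥(Finset.Iic n)) → Ω × Bool =>
            h ⟨n, Finset.mem_Iic.2 le_rfl⟩) (measurable_pi_apply _))) := by
  have h := splitChain_regeneration κs μs (κ := κ) (ν := ν) (hmin := hmin) hε hκs a hF hCF
    (g := fun _ => (1 : ℝ)) measurable_const (Cg := 1) (fun _ => by simp)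
  rw [integral_const, probReal_univ, one_smul, mul_one] at h
  exact h

end SplitChain

end Summit.Ventures.LatticeQCDFlow.Scoring

end
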